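import Summits.ResolutionOfSingularities.ResolutionOfSingularities.Theorems.FrobeniusLadderFInjectiveMacaulayficationFCUnguardedAprime
import Summits.ResolutionOfSingularities.ResolutionOfSingularities.Theorems.FrobeniusLadderFInjectiveMacaulayficationSpreadLocFix
import HarnessLib

/-!
# (T2′) `SpreadGoodAprime` DISCHARGED modulo the two openness theorems (HOLE #3 route (A′) of the crux `FInjectiveMacaulayfication`
# stmt-ResolutionOfSingularities-15315, chain w45a; res-L1-w45a-plan-1 R16.12 (4) / R16.17 (3) «stub-2: `spreadGoodAprime_of (hDM) (hCMo) :
# FCUnguardedAprime.SpreadGoodAprime`, binders = p566975 §2 verbatim»; seat res-L1-w45a-stub-2)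

[OURS · L1 W4.5a] Support file (`--supports stmt-ResolutionOfSingularities-15315 --as helper`); NOT a statement of any manuscript; CONDITIONAL results
(on `NonFullLocusClosed`, i.e. on Datta–Murayama 2024 Thm. B + openness of the Cohen–Macaulay locus BY NAME); def-free; AI-written (AI review is
weaker than expert review).

* `spreadGoodAprime_of_nonFullLocusClosed (hNF) : FCUnguardedAprime.SpreadGoodAprime` and `spreadGoodAprime_of (hDM) (hCMo)` — (T2′) of the
  HOLE-#3 text of record (res-L1-w45a-stub-3 FC2Dim4Sig v0.7 = tree `FCUnguardedAprime`, res-L1-w45a-stub-1 p566975), by the kernel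
  `SpreadLocFix.exists_spread_goodOver_of_locFixData`;
* `spreadGood_of_locFixData` — the SAME conclusion from the WEAKER datum `LocFixData` (fibre over `𝔪_η` only): fullness of the blow-up over the
  proper generizations of `η` is a CONSEQUENCE (closed non-FULL locus + proper `π`), so the (A′) assembly may consume (T1′) `LocFixAtNonClosed`
  directly and (T1″) `LocFixFullAtNonClosed` is not needed for it.
The binders `IsSeparated f₁`, `4 ≤ topologicalKrullDim X₁`, «all stalks CM» of (T2′) are idle in the proof.
[cite: DattaMurayama2024, Thm. B] [cite: StacksProject, Tag 0804]
-/

-- single-problem summit: the doubled namespace component is forced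
set_option linter.dupNamespace false

noncomputable section

namespace Summit.ResolutionOfSingularities.ResolutionOfSingularities.Theorems.FInjectiveMacaulayfication.SpreadGoodAprimeOf

open CategoryTheory AlgebraicGeometry TopologicalSpace IsLocalRing
open Literature.AlgebraicGeometry.Resolution
open Summit.ResolutionOfSingularities.ResolutionOfSingularities.Theorems.FInjectiveMacaulayfication
open SliceableCentre FCUnguardedAprime

/-- **(T2′) from an (A′) datum over `𝔪_η` only** (`LocFixData`, not `LocFixDataFull`), in the binder shape of `FCUnguardedAprime.SpreadGoodAprime`,
conditional on `NonFullLocusClosed`. [OURS · conditional-result] [cite: StacksProject, Tag 0804] -/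
theorem spreadGood_of_locFixData (hNF : NonFullLocusClosed.NonFullLocusClosed) :
    ∀ (p : ℕ), p.Prime → ∀ (k : Type) [Field k] [CharP k p]
      (X₁ : Scheme.{0}) (f₁ : X₁ ⟶ Spec (.of k)),
        IsSeparated f₁ → LocallyOfFiniteType f₁ → QuasiCompact f₁ → IsIntegral X₁ → 4 ≤ topologicalKrullDim X₁ →
        (∀ x : X₁, CMCl (X₁.presheaf.stalk x)) →
        ∀ (η : X₁) (n' : ℕ) (c' : Fin n' → X₁.presheaf.stalk η), LocFixData p X₁ η n' c' →
          ∃ (J : X₁.IdealSheafData) (U : X₁.Opens), J ≠ ⊥ ∧ η ∈ (J.support : Set X₁) ∧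
            stalkIdeal J η = Ideal.span (Set.range c') ∧ η ∈ (U : Set X₁) ∧
            GoodOver p X₁ J ((J.support : Set X₁) ∩ (U : Set X₁)) := by
  intro p hp k _ _ X₁ f₁ _ hft hqc hint _ _ η n' c' hdat
  haveI := hft
  haveI := hqc
  haveI := hint
  obtain ⟨J, U, hJ0, hηJ, hJη, hηU, hgood⟩ :=
    SpreadLocFix.exists_spread_goodOver_of_locFixData hNF p hp k X₁ f₁ η n' c' hdat.1 hdat.2.1 hdat.2.2
  exact ⟨J, U, hJ0, hηJ, hJη, hηU, hgood⟩

/-- **(T2′) `SpreadGoodAprime` of the HOLE-#3 text of record, conditional on `NonFullLocusClosed`.** [OURS · conditional-result] -/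
theorem spreadGoodAprime_of_nonFullLocusClosed (hNF : NonFullLocusClosed.NonFullLocusClosed) : FCUnguardedAprime.SpreadGoodAprime := by
  intro p hp k _ _ X₁ f₁ hsep hft hqc hint h4 hCM η n' c' hfull
  exact spreadGood_of_locFixData hNF p hp k X₁ f₁ hsep hft hqc hint h4 hCM η n' c' (locFixData_of_full hfull)

/-- **(T2′) `SpreadGoodAprime` modulo the two printed openness theorems BY NAME**: Datta–Murayama 2024 Thm. B
(`DattaMurayama2024_fInjectiveLocusOpen`) and openness of the Cohen–Macaulay locus (`NonFullLocusClosed.CMLocusOpen`; EGA IV₂ 6.11.2, Literature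
fact `EGAIV2_cohenMacaulayLocusOpen`). [OURS · conditional-result] [cite: DattaMurayama2024, Thm. B] -/
theorem spreadGoodAprime_of
    (hDM : Literature.AlgebraicGeometry.Resolution.DattaMurayama2024_fInjectiveLocusOpen.{0})
    (hCMo : NonFullLocusClosed.CMLocusOpen) : FCUnguardedAprime.SpreadGoodAprime :=
  spreadGoodAprime_of_nonFullLocusClosed (NonFullLocusClosed.nonFullLocusClosed_of_named hDM hCMo)

/-! ## «Good over ALL of `U`» (res-L1-w45a-plan-1 R16.33 (4)) -/

/-- **`spreadGoodAprimeLF_all`** — (T2′) from the datum `LocFixData` with the conclusion `GoodOver p X₁ J U` over the WHOLE open `U ∋ η`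
(junk rule M2: goodness over an open set is the currency downstream steps consume), conditional on `NonFullLocusClosed`; binders = those of
`FCUnguardedAprime.SpreadGoodAprime` with `LocFixDataFull ↦ LocFixData`. [OURS · conditional-result] -/
theorem spreadGoodAprimeLF_all (hNF : NonFullLocusClosed.NonFullLocusClosed) :
    ∀ (p : ℕ), p.Prime → ∀ (k : Type) [Field k] [CharP k p]
      (X₁ : Scheme.{0}) (f₁ : X₁ ⟶ Spec (.of k)),
        IsSeparated f₁ → LocallyOfFiniteType f₁ → QuasiCompact f₁ → IsIntegral X₁ → 4 ≤ topologicalKrullDim X₁ →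
        (∀ x : X₁, CMCl (X₁.presheaf.stalk x)) →
        ∀ (η : X₁) (n' : ℕ) (c' : Fin n' → X₁.presheaf.stalk η), LocFixData p X₁ η n' c' →
          ∃ (J : X₁.IdealSheafData) (U : X₁.Opens), J ≠ ⊥ ∧ η ∈ (J.support : Set X₁) ∧
            stalkIdeal J η = Ideal.span (Set.range c') ∧ η ∈ (U : Set X₁) ∧
            GoodOver p X₁ J (U : Set X₁) := by
  intro p hp k _ _ X₁ f₁ _ hft hqc hint _ _ η n' c' hdat
  haveI := hft
  haveI := hqc
  haveI := hint
  obtain ⟨J, U, hJ0, hηJ, hJη, hηU, hgood⟩ :=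
    SpreadLocFix.exists_spread_goodOver_all_of_locFixData hNF p hp k X₁ f₁ η n' c' hdat.1 hdat.2.1 hdat.2.2
  exact ⟨J, U, hJ0, hηJ, hJη, hηU, hgood⟩

/-- `spreadGoodAprimeLF_all` modulo the two printed openness theorems BY NAME (Datta–Murayama 2024 Thm. B; openness of the Cohen–Macaulay
locus). [OURS · conditional-result] [cite: DattaMurayama2024, Thm. B] -/
theorem spreadGoodAprimeLF_all_of
    (hDM : Literature.AlgebraicGeometry.Resolution.DattaMurayama2024_fInjectiveLocusOpen.{0})
    (hCMo : NonFullLocusClosed.CMLocusOpen) :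
    ∀ (p : ℕ), p.Prime → ∀ (k : Type) [Field k] [CharP k p]
      (X₁ : Scheme.{0}) (f₁ : X₁ ⟶ Spec (.of k)),
        IsSeparated f₁ → LocallyOfFiniteType f₁ → QuasiCompact f₁ → IsIntegral X₁ → 4 ≤ topologicalKrullDim X₁ →
        (∀ x : X₁, CMCl (X₁.presheaf.stalk x)) →
        ∀ (η : X₁) (n' : ℕ) (c' : Fin n' → X₁.presheaf.stalk η), LocFixData p X₁ η n' c' →
          ∃ (J : X₁.IdealSheafData) (U : X₁.Opens), J ≠ ⊥ ∧ η ∈ (J.support : Set X₁) ∧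
            stalkIdeal J η = Ideal.span (Set.range c') ∧ η ∈ (U : Set X₁) ∧
            GoodOver p X₁ J (U : Set X₁) :=
  spreadGoodAprimeLF_all (NonFullLocusClosed.nonFullLocusClosed_of_named hDM hCMo)

end Summit.ResolutionOfSingularities.ResolutionOfSingularities.Theorems.FInjectiveMacaulayfication.SpreadGoodAprimeOf

end
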